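import Summits.BirchSwinnertonDyer.BirchSwinnertonDyer.Theorems.AlignedTransportAtTwoMainConjectureOfRankZeroBSDAtTwoFineRoadCoinvDefect
import HarnessLib

/-!
# Route `AlignedTransportAtTwo`, crux C2 `MainConjectureOfRankZeroBSDAtTwo` (stmt-BirchSwinnertonDyer-22298):
# road (b″) NETTED AT INFINITY — the period `2^{[Δ_E>0]}` cancels against the archimedean `(Λ/2)^{[Δ_E>0]}`

HONEST FRAMING (cell `bsd-f1-sign2`, WIDTH-5 attached prover seat `bsd-line-att-p3` gen 3, line `birth` of the
lead `bsd-line-att-p2`; BSD is NOT proved by any of this). THEOREMS ONLY; nothing asserted. This file is the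
kernel algebra of the lead's ARCH-NETTING proposal (crux workfile `ARCH-NETTING.md`, 2026-08-28): on road (b″)
the unit equation of Kato's best INTEGRAL class at `p = 2` reads `a + b = s·2^{[Δ_E>0]}·G₊` (REF1-AUDIT §57:
the period of a good `γ` is `Ω_E/2` for both signs, `Ω_E/c_∞` at best), while on the descent side the
Pontryagin dual `X^{rel}` of the Selmer group of `E/ℚ_∞` with NO condition at the real places surjects onto
the true dual `X^{str} = X(E/ℚ_∞)` with kernel `(Λ/2Λ)^{[Δ_E>0]}` (Greenberg, LNM 1716, Lemma 4.6 and its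
proof at `p = 2`: the archimedean factor of `𝒫_E^Σ(ℚ_∞)` is `Hom(Λ/2Λ, ℤ/2)` iff `E[2] ⊂ E(ℝ)`, and the
global-to-local map is onto it when `Sel` is `Λ`-cotorsion). Descending Kato's row over the totally
imaginary tower `K_∞ = ℚ(ζ_{2^∞})` to the RELAXED target `X^{rel}` (inf–res: finite cokernel, no archimedean
term, both signs) the two `2`'s CANCEL. As kernel algebra:

* §1 `lengthAt_le_of_coinvDatum_netting` (any `p`) — road-(b″) row + injective `Δ`-equivariant Coleman map
  with finite cokernel + `w₁, w₂ ∈ ker toX`, `col wᵢ = (a,b), (b,a)` + `a + b = p^e·s·G` (`s ∉ (p)`) + a descent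
  map `fd : X'_Δ → X^{rel}` with FINITE COKERNEL (no hypothesis on its kernel) + a surjection
  `q : X^{rel} ↠ X_D` with `e ≤ ℓ_{(p)}(ker q)` ⟹ `ℓ_{(p)}(X_D) ≤ ℓ_{(p)}(Λ/(G)) + ℓ_{(p)}(Y'_Δ)`.
  No balance, no `fy`, no torsion hypothesis: the FINE SIDE STAYS UPSTAIRS (`Y' = X₀(E/K_∞)`, its
  `Δ`-coinvariants); a fine comparison `fy : Y'_Δ → X_Y` only adds `ℓ(Y'_Δ) ≤ ℓ(ker fy) + ℓ(X_Y)`.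
* §2 at `2`, per cyclotomic datum: `selmerDual_mu_eq_zero_of_roadB2_netting_two` (`red G₊ ≠ 0` and
  `ℓ_{(2)}(Y'_Δ) = 0` ⟹ `μ(X(E/ℚ_∞)) = 0`); `…_netting_strictFine_two` (fine input through the tree's STRICT
  fine dual `X₀(E/ℚ_∞)` and a comparison `fy` with `ℓ(ker fy) = 0` — honest for `Δ_E < 0`, where relaxed =
  strict; statement (A) at `(E,2)` over `ℚ`). The companion file `…FineRoadArchNettingQi` takes the fine
  input UPSTAIRS instead (statement (A) at `2` for the `ℚ(i)`-model, whose dual fine Selmer module IS `Y'` — no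
  descent on the fine side at all, hence no narrow class group).
* §3 the crux: `seedMuZeroAtTwo_of_fineRoadNetting` / `mainConjectureOfRankZeroBSDAtTwo_of_fineRoadNetting` —
  stub T and C2 BY NAME from PRINT {modularity, Lim 2017 Thm. 3.5 at `2`} + the DISPLAYED netted data K₂ⁿᵉᵗ
  (Kato's row over `ℚ(ζ_{2^∞})`, 17.11, the integral class with its `2`-power `e`, the relaxed descent with
  finite cokernel, the archimedean extension `q` with `e ≤ ℓ(ker q)`, the fine comparison) + (A₂).
  CONDITIONAL; the item stays open. As with every `∃`-over-Types data shape (att-p3 g2 `…CoinvDataJunk`), the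
  displayed data certify no provenance; the registered stub remains the bare `μ`-inequality.

References: K. Kato, Astérisque 295 (2004), Thm. 12.5 (4), Thm. 17.4 (1), Prop. 17.11, §17.13; R. Greenberg,
LNM 1716 (1999), Lemma 4.6 and pp. 98–99 (archimedean primes at `p = 2`); M. F. Lim, Asian J. Math. 21 (2017)
Thm. 3.5; J. Coates, R. Sujatha, Math. Ann. 331 (2005) §3.
-/

set_option linter.dupNamespace false
set_option autoImplicit false

noncomputable section

open scoped Classical

open Literature.NumberTheory.EllipticCurves Literature.NumberTheory.EllipticCurves.Module

namespace Summit.BirchSwinnertonDyer.BirchSwinnertonDyer.Theorems.AlignedTransportAtTwoFineRoad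

/-! ## §1 The netting lemma -/

section Netting

variable (p : ℕ) [Fact p.Prime]
  {P X' Y' Xr XD XY : Type*} [AddCommGroup P] [_root_.Module (IwasawaAlgebra p) P]
  [AddCommGroup X'] [_root_.Module (IwasawaAlgebra p) X']
  [AddCommGroup Y'] [_root_.Module (IwasawaAlgebra p) Y']
  [AddCommGroup Xr] [_root_.Module (IwasawaAlgebra p) Xr]
  [AddCommGroup XD] [_root_.Module (IwasawaAlgebra p) XD]
  [AddCommGroup XY] [_root_.Module (IwasawaAlgebra p) XY]

/-- **THE NETTING LEMMA (road (b″) with a relaxed descent target).** Over `Λ₀ = ℤ_p⟦T⟧` at `𝔭 = (p)`: a row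
`P → X' → Y' → 0` with `Δ`-action, an injective `Δ`-equivariant Coleman map `col : P → Λ₀ × Λ₀` with finite
cokernel, `w₁, w₂ ∈ ker toX` with `col w₁ = (a,b)`, `col w₂ = (b,a)` and the unit equation WITH A `p`-POWER
DEFECT `a + b = p^e·s·G` (`s ∉ (p)`); a descent map `fd : X'_Δ → X^{rel}` with FINITE COKERNEL (nothing asked
of its kernel) and a surjection `q : X^{rel} ↠ X_D` whose kernel has `(p)`-length AT LEAST `e` (at `p = 2`:
Greenberg's archimedean `(Λ/2)^{[Δ_E>0]} = ker(X^{rel} ↠ X^{str})` against REF1's period `2^{[Δ_E>0]}`). Then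
`ℓ_{(p)}(X_D) ≤ ℓ_{(p)}(Λ₀/(G)) + ℓ_{(p)}(Y'_Δ)` — the defect `e` CANCELS, and the fine side is not descended.
[cite: Kato2004Asterisque, Thm. 12.5 (4), Prop. 17.11, §17.13 (pp. 227, 277–280)]
[cite: GreenbergLNM1716, Lemma 4.6 and pp. 98–99] -/
theorem lengthAt_le_of_coinvDatum_netting (𝔭 : PrimeSpectrum (IwasawaAlgebra p))
    (h𝔭 : 𝔭.asIdeal = IwasawaAlgebra.augIdealP p)
    (toX : P →ₗ[IwasawaAlgebra p] X') (π : X' →ₗ[IwasawaAlgebra p] Y') (hX : Function.Exact toX π)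
    (hπ : Function.Surjective π) (cP : P →ₗ[IwasawaAlgebra p] P) (cX : X' →ₗ[IwasawaAlgebra p] X')
    (cY : Y' →ₗ[IwasawaAlgebra p] Y') (hcX : toX ∘ₗ cP = cX ∘ₗ toX) (hcY : π ∘ₗ cX = cY ∘ₗ π)
    (col : P →ₗ[IwasawaAlgebra p] IwasawaAlgebra p × IwasawaAlgebra p) (hcol : Function.Injective col)
    (hccol : col ∘ₗ cP = (LinearEquiv.prodComm (IwasawaAlgebra p) (IwasawaAlgebra p) (IwasawaAlgebra p) :
      IwasawaAlgebra p × IwasawaAlgebra p →ₗ[IwasawaAlgebra p] IwasawaAlgebra p × IwasawaAlgebra p) ∘ₗ col)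
    (hfin : Finite ((IwasawaAlgebra p × IwasawaAlgebra p) ⧸ LinearMap.range col))
    {w₁ w₂ : P} (h₁ : toX w₁ = 0) (h₂ : toX w₂ = 0) {a b s G : IwasawaAlgebra p} {e : ℕ}
    (hw₁ : col w₁ = (a, b)) (hw₂ : col w₂ = (b, a)) (hs : s ∉ IwasawaAlgebra.augIdealP p)
    (hab : a + b = PowerSeries.C ((p : ℤ_[p]) ^ e) * s * G)
    (fd : (X' ⧸ LinearMap.range (cX - 1)) →ₗ[IwasawaAlgebra p] Xr) (hfd : Finite (Xr ⧸ LinearMap.range fd))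
    (q : Xr →ₗ[IwasawaAlgebra p] XD) (hq : Function.Surjective q)
    (he : (e : ℕ∞) ≤ lengthAt (IwasawaAlgebra p) (LinearMap.ker q) 𝔭) :
    lengthAt (IwasawaAlgebra p) XD 𝔭 ≤
      lengthAt (IwasawaAlgebra p) (IwasawaAlgebra p ⧸ Ideal.span {G}) 𝔭 +
        lengthAt (IwasawaAlgebra p) (Y' ⧸ LinearMap.range (cY - 1)) 𝔭 := by
  haveI := hfin
  haveI := hfd
  have hc : lengthAt (IwasawaAlgebra p) ((IwasawaAlgebra p × IwasawaAlgebra p) ⧸ LinearMap.range col) 𝔭 = 0 :=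
    lengthAt_augIdealP_eq_zero_of_finite p _ 𝔭 h𝔭
  -- the coinvariant bound: only the even branch `a + b` enters
  have h1 := lengthAt_coinv_le_of_roadB2 toX π hX hπ cP cX cY hcX hcY col hcol hccol h₁ h₂ hw₁ hw₂ 𝔭
  rw [hc, zero_add, hab, lengthAt_quotient_span_C_pow_mul_mul p e hs G 𝔭 h𝔭] at h1
  -- `ℓ(X^{rel}) = ℓ(range fd) ≤ ℓ(X'_Δ)` (finite cokernel)
  have h2 : lengthAt (IwasawaAlgebra p) Xr 𝔭 ≤
      lengthAt (IwasawaAlgebra p) (X' ⧸ LinearMap.range (cX - 1)) 𝔭 := by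
    rw [lengthAt_eq_add_quotient (LinearMap.range fd) 𝔭,
      lengthAt_augIdealP_eq_zero_of_finite p (Xr ⧸ LinearMap.range fd) 𝔭 h𝔭, add_zero]
    exact lengthAt_le_of_surjective fd.rangeRestrict fd.surjective_rangeRestrict 𝔭
  -- `e + ℓ(X_D) ≤ ℓ(ker q) + ℓ(X_D) = ℓ(X^{rel})`
  have h3 : (e : ℕ∞) + lengthAt (IwasawaAlgebra p) XD 𝔭 ≤ lengthAt (IwasawaAlgebra p) Xr 𝔭 := by
    rw [lengthAt_eq_add_quotient (LinearMap.ker q) 𝔭,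
      lengthAt_eq_of_linearEquiv (q.quotKerEquivOfSurjective hq) 𝔭]
    exact add_le_add he le_rfl
  have h4 : (e : ℕ∞) + lengthAt (IwasawaAlgebra p) XD 𝔭 ≤
      (e : ℕ∞) + (lengthAt (IwasawaAlgebra p) (IwasawaAlgebra p ⧸ Ideal.span {G}) 𝔭 +
        lengthAt (IwasawaAlgebra p) (Y' ⧸ LinearMap.range (cY - 1)) 𝔭) := by
    rw [← add_assoc]
    exact h3.trans (h2.trans h1)
  exact (ENat.add_le_add_iff_left (ENat.coe_ne_top e)).mp h4

end Netting

/-! ## §2 At `2`, per cyclotomic datum -/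

section AtTwo

open WeierstrassCurve Summit.BirchSwinnertonDyer.Rank1Residual.X1.MuLambda

variable (W : WeierstrassCurve ℚ) {κ : ZpExtension ℚ 2} {γ : Field.absoluteGaloisGroup ℚ}

/-- **ROAD (b″) NETTED AT `∞`, per cyclotomic datum.** `X = X(E/ℚ_∞)` (`D`, strict dual). GIVEN (displayed,
not asserted): Kato's row `P → X' → Y' → 0` over `K_∞ = ℚ(ζ_{2^∞})` with `Δ`-action (`X' = X(E/K_∞)`,
`Y' = X₀(E/K_∞)`), an injective `Δ`-equivariant Coleman map with finite cokernel (Prop. 17.11), the two zeta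
images with `a + b = 2^e·s·G₊`, `s ∉ (2)` (REF1 §57: `e = [Δ_E > 0]` for the best integral class), a
RELAXED descent `fd : X'_Δ → X^{rel}` with finite cokernel (inf–res; no archimedean term), the archimedean
extension `q : X^{rel} ↠ X` with `e ≤ ℓ_{(2)}(ker q)` (Greenberg L. 4.6 at `p = 2`: `ker = (Λ/2)^{[Δ_E>0]}`),
the even-branch analytic `μ₂ = 0` (`red G₊ ≠ 0`) and `ℓ_{(2)}(Y'_Δ) = 0` (statement (A) upstairs) — THEN
`μ(X(E/ℚ_∞)) = 0`. [cite: Kato2004Asterisque, Thm. 17.4 (1) (p. 273), Prop. 17.11 (p. 277), §17.13 (pp. 279–280)]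
[cite: GreenbergLNM1716, Lemma 4.6 and pp. 98–99] [cite: CoatesSujatha2005, statement (A) (§3)] -/
theorem selmerDual_mu_eq_zero_of_roadB2_netting_two (D : W.SelmerDualData κ γ)
    {G : IwasawaAlgebra 2} (hred : red G ≠ 0)
    {P X' Y' Xr : Type*} [AddCommGroup P] [_root_.Module (IwasawaAlgebra 2) P]
    [AddCommGroup X'] [_root_.Module (IwasawaAlgebra 2) X']
    [AddCommGroup Y'] [_root_.Module (IwasawaAlgebra 2) Y']
    [AddCommGroup Xr] [_root_.Module (IwasawaAlgebra 2) Xr]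
    (toX : P →ₗ[IwasawaAlgebra 2] X') (π : X' →ₗ[IwasawaAlgebra 2] Y') (hX : Function.Exact toX π)
    (hπ : Function.Surjective π) (cP : P →ₗ[IwasawaAlgebra 2] P) (cX : X' →ₗ[IwasawaAlgebra 2] X')
    (cY : Y' →ₗ[IwasawaAlgebra 2] Y') (hcX : toX ∘ₗ cP = cX ∘ₗ toX) (hcY : π ∘ₗ cX = cY ∘ₗ π)
    (col : P →ₗ[IwasawaAlgebra 2] IwasawaAlgebra 2 × IwasawaAlgebra 2) (hcol : Function.Injective col)
    (hccol : col ∘ₗ cP = (LinearEquiv.prodComm (IwasawaAlgebra 2) (IwasawaAlgebra 2) (IwasawaAlgebra 2) :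
      IwasawaAlgebra 2 × IwasawaAlgebra 2 →ₗ[IwasawaAlgebra 2] IwasawaAlgebra 2 × IwasawaAlgebra 2) ∘ₗ col)
    (hfin : Finite ((IwasawaAlgebra 2 × IwasawaAlgebra 2) ⧸ LinearMap.range col))
    {w₁ w₂ : P} (h₁ : toX w₁ = 0) (h₂ : toX w₂ = 0) {a b s : IwasawaAlgebra 2} {e : ℕ} (hw₁ : col w₁ = (a, b))
    (hw₂ : col w₂ = (b, a)) (hs : s ∉ IwasawaAlgebra.augIdealP 2)
    (hab : a + b = PowerSeries.C ((2 : ℤ_[2]) ^ e) * s * G)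
    (fd : (X' ⧸ LinearMap.range (cX - 1)) →ₗ[IwasawaAlgebra 2] Xr) (hfd : Finite (Xr ⧸ LinearMap.range fd))
    (q : Xr →ₗ[IwasawaAlgebra 2] D.X) (hq : Function.Surjective q)
    (he : (e : ℕ∞) ≤ lengthAt (IwasawaAlgebra 2) (LinearMap.ker q)
      ⟨IwasawaAlgebra.augIdealP 2, IwasawaAlgebra.isPrime_augIdealP_holds 2⟩)
    (hA : lengthAt (IwasawaAlgebra 2) (Y' ⧸ LinearMap.range (cY - 1))
      ⟨IwasawaAlgebra.augIdealP 2, IwasawaAlgebra.isPrime_augIdealP_holds 2⟩ = 0) : D.mu = 0 := by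
  let 𝔭 : PrimeSpectrum (IwasawaAlgebra 2) :=
    ⟨IwasawaAlgebra.augIdealP 2, IwasawaAlgebra.isPrime_augIdealP_holds 2⟩
  have h := lengthAt_le_of_coinvDatum_netting 2 𝔭 rfl toX π hX hπ cP cX cY hcX hcY col hcol hccol hfin h₁ h₂
    hw₁ hw₂ hs (by exact_mod_cast hab) fd hfd q hq he
  have hq0 : lengthAt (IwasawaAlgebra 2) (IwasawaAlgebra 2 ⧸ Ideal.span {G}) 𝔭 = 0 :=
    lengthAt_quotient_eq_zero_of_not_le
      (by rw [Ideal.span_singleton_le_iff_mem]; exact not_mem_augIdealP_of_red_ne_zero hred)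
  have hA' : lengthAt (IwasawaAlgebra 2) (Y' ⧸ LinearMap.range (cY - 1)) 𝔭 = 0 := hA
  rw [hq0, hA', add_zero] at h
  have hX0 : lengthAt (IwasawaAlgebra 2) D.X 𝔭 = 0 := nonpos_iff_eq_zero.mp h
  change muInvariant 2 D.X = 0
  rw [muInvariant_eq_toNat_lengthAt 2 D.X 𝔭 rfl, hX0]
  rfl

/-- **Netted road (b″), fine input through the STRICT fine dual over `ℚ`.** As
`selmerDual_mu_eq_zero_of_roadB2_netting_two`, with `ℓ_{(2)}(Y'_Δ) = 0` obtained from a fine comparison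
`fy : Y'_Δ → X₀(E/ℚ_∞)` (`Yd`, the tree's dual fine Selmer datum — strict at `∞`) with `ℓ_{(2)}(ker fy) = 0`
and statement (A) at `(E,2)` over `ℚ` (`Sel₀(ℚ_∞, E[2^∞])[2]` finite). The kernel clause is the honest one for
`Δ_E < 0` (no real condition: relaxed = strict); for `Δ_E > 0` it says that the relaxed fine classes have
`μ`-trivial real signature. [cite: Kato2004Asterisque, §17.13 (pp. 279–280)] [cite: GreenbergLNM1716, Lemma 4.6 and pp. 98–99]
[cite: CoatesSujatha2005, statement (A) (§3)] -/
theorem selmerDual_mu_eq_zero_of_roadB2_netting_strictFine_two (hγ : κ.IsTopGenerator γ)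
    (D : W.SelmerDualData κ γ) (Yd : W.FineSelmerDualData κ γ)
    (hAfin : Set.Finite {s : W.fineSelmerInfty κ | 2 • s = 0}) {G : IwasawaAlgebra 2} (hred : red G ≠ 0)
    {P X' Y' Xr : Type*} [AddCommGroup P] [_root_.Module (IwasawaAlgebra 2) P]
    [AddCommGroup X'] [_root_.Module (IwasawaAlgebra 2) X']
    [AddCommGroup Y'] [_root_.Module (IwasawaAlgebra 2) Y']
    [AddCommGroup Xr] [_root_.Module (IwasawaAlgebra 2) Xr]
    (toX : P →ₗ[IwasawaAlgebra 2] X') (π : X' →ₗ[IwasawaAlgebra 2] Y') (hX : Function.Exact toX π)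
    (hπ : Function.Surjective π) (cP : P →ₗ[IwasawaAlgebra 2] P) (cX : X' →ₗ[IwasawaAlgebra 2] X')
    (cY : Y' →ₗ[IwasawaAlgebra 2] Y') (hcX : toX ∘ₗ cP = cX ∘ₗ toX) (hcY : π ∘ₗ cX = cY ∘ₗ π)
    (col : P →ₗ[IwasawaAlgebra 2] IwasawaAlgebra 2 × IwasawaAlgebra 2) (hcol : Function.Injective col)
    (hccol : col ∘ₗ cP = (LinearEquiv.prodComm (IwasawaAlgebra 2) (IwasawaAlgebra 2) (IwasawaAlgebra 2) :
      IwasawaAlgebra 2 × IwasawaAlgebra 2 →ₗ[IwasawaAlgebra 2] IwasawaAlgebra 2 × IwasawaAlgebra 2) ∘ₗ col)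
    (hfin : Finite ((IwasawaAlgebra 2 × IwasawaAlgebra 2) ⧸ LinearMap.range col))
    {w₁ w₂ : P} (h₁ : toX w₁ = 0) (h₂ : toX w₂ = 0) {a b s : IwasawaAlgebra 2} {e : ℕ} (hw₁ : col w₁ = (a, b))
    (hw₂ : col w₂ = (b, a)) (hs : s ∉ IwasawaAlgebra.augIdealP 2)
    (hab : a + b = PowerSeries.C ((2 : ℤ_[2]) ^ e) * s * G)
    (fd : (X' ⧸ LinearMap.range (cX - 1)) →ₗ[IwasawaAlgebra 2] Xr) (hfd : Finite (Xr ⧸ LinearMap.range fd))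
    (q : Xr →ₗ[IwasawaAlgebra 2] D.X) (hq : Function.Surjective q)
    (he : (e : ℕ∞) ≤ lengthAt (IwasawaAlgebra 2) (LinearMap.ker q)
      ⟨IwasawaAlgebra.augIdealP 2, IwasawaAlgebra.isPrime_augIdealP_holds 2⟩)
    (fy : (Y' ⧸ LinearMap.range (cY - 1)) →ₗ[IwasawaAlgebra 2] Yd.X)
    (hfy : lengthAt (IwasawaAlgebra 2) (LinearMap.ker fy)
      ⟨IwasawaAlgebra.augIdealP 2, IwasawaAlgebra.isPrime_augIdealP_holds 2⟩ = 0) : D.mu = 0 := by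
  let 𝔭 : PrimeSpectrum (IwasawaAlgebra 2) :=
    ⟨IwasawaAlgebra.augIdealP 2, IwasawaAlgebra.isPrime_augIdealP_holds 2⟩
  have hYd : lengthAt (IwasawaAlgebra 2) Yd.X 𝔭 = 0 :=
    lengthAt_fineSelmerDual_eq_zero_of_finite_twoTorsion W hγ Yd hAfin
  have hfy' : lengthAt (IwasawaAlgebra 2) (LinearMap.ker fy) 𝔭 = 0 := hfy
  have hA : lengthAt (IwasawaAlgebra 2) (Y' ⧸ LinearMap.range (cY - 1)) 𝔭 = 0 := by
    have h := lengthAt_le_ker_add fy 𝔭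
    rw [hYd, hfy', add_zero] at h
    exact nonpos_iff_eq_zero.mp h
  exact selmerDual_mu_eq_zero_of_roadB2_netting_two W D hred toX π hX hπ cP cX cY hcX hcY col hcol hccol hfin
    h₁ h₂ hw₁ hw₂ hs hab fd hfd q hq he hA

end AtTwo

/-! ## §3 The crux on the netted road -/

section Crux

open CongruenceSubgroup WeierstrassCurve Literature.NumberTheory.EllipticCurves.ModularForms
  Literature.NumberTheory.EllipticCurves.Greenberg1999
  Literature.NumberTheory.EllipticCurves.Rank1Residual
  Literature.NumberTheory.IwasawaTheory
  Summit.BirchSwinnertonDyer.Rank1Residual Summit.BirchSwinnertonDyer.Rank1Residual.X1.MuLambda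
  Summit.BirchSwinnertonDyer.Rank1Residual.X5 Summit.BirchSwinnertonDyer.Rank1Residual.F1Sign2
  Summit.BirchSwinnertonDyer.BirchSwinnertonDyer.Theorems.Rank1ResidualX1Defs
  Summit.BirchSwinnertonDyer.BirchSwinnertonDyer.Theses.AlignedTransportAtTwo

/-- **Stub T of line `birth` on the NETTED road (b″) (K₂ⁿᵉᵗ).** Modularity + Lim 2017 at `2` + for every
seed-cell curve and cyclotomic datum the DISPLAYED netted data (Kato's row over `ℚ(ζ_{2^∞})` with `Δ`-action,
injective `Δ`-equivariant Coleman map with finite cokernel, zeta images with `a + b = 2^e·s·G₊` for SOME `e`,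
a relaxed descent `fd : X'_Δ → X^{rel}` with finite cokernel, an archimedean extension `q : X^{rel} ↠ X(W/ℚ_∞)`
with `e ≤ ℓ_{(2)}(ker q)`, a fine comparison `fy : Y'_Δ → X₀(W/ℚ_∞)` with `ℓ_{(2)}(ker fy) = 0`; nothing
asserted — for `e = [Δ_W > 0]` these are REF1 §57 + Greenberg L. 4.6 + inf–res) + (A₂) classical `μ = 0` of a
`2`-power-index subfield of `ℚ(W[4])` ⟹ `SeedMuZeroAtTwo`. [cite: Kato2004Asterisque, Thm. 17.4 (1), Prop. 17.11, §17.13 (pp. 273–280)]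
[cite: Lim2017FineSelmer, §3 Thm. 3.5 and Lemma 3.2] [cite: GreenbergLNM1716, Lemma 4.6 and pp. 98–99] -/
theorem seedMuZeroAtTwo_of_fineRoadNetting (hmod : nonempty_modularParametrizationData)
    (hLim : Lim2017.thm35_at_two_fineSelmerDual_moduleFinite_of_classicalMuVanishes_of_le_divisionField_four)
    (hK2n : ∀ (W : WeierstrassCurve ℚ) [W.IsElliptic] [W.IsGloballyMinimal], IsOrdinaryAt W 2 →
      (∀ x : ℚ, ¬ HasRationalTwoTorsionX W x) →
      ∀ (κ : ZpExtension ℚ 2) (γ : Field.absoluteGaloisGroup ℚ), κ.IsCyclotomic →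
      κ.IsTopGenerator γ → IsCyclotomicVariable 2 γ →
      ∀ ⦃N : ℕ⦄ [NeZero N] (f : CuspForm (Gamma0 N) 2), IsNewformOf W f →
      ∀ Gp : IwasawaAlgebra 2, iwasawaToPowerSeries 2 Gp = padicLFunction f (unitRoot W 2 : ℚ_[2]) →
      ∀ (D : W.SelmerDualData κ γ) (Yd : W.FineSelmerDualData κ γ),
        ∃ (P X' Y' Xr : Type) (_ : AddCommGroup P) (_ : _root_.Module (IwasawaAlgebra 2) P)
          (_ : AddCommGroup X') (_ : _root_.Module (IwasawaAlgebra 2) X')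
          (_ : AddCommGroup Y') (_ : _root_.Module (IwasawaAlgebra 2) Y')
          (_ : AddCommGroup Xr) (_ : _root_.Module (IwasawaAlgebra 2) Xr)
          (toX : P →ₗ[IwasawaAlgebra 2] X') (π : X' →ₗ[IwasawaAlgebra 2] Y')
          (cP : P →ₗ[IwasawaAlgebra 2] P) (cX : X' →ₗ[IwasawaAlgebra 2] X')
          (cY : Y' →ₗ[IwasawaAlgebra 2] Y')
          (col : P →ₗ[IwasawaAlgebra 2] IwasawaAlgebra 2 × IwasawaAlgebra 2) (w₁ w₂ : P)
          (a b s : IwasawaAlgebra 2) (e : ℕ) (fd : (X' ⧸ LinearMap.range (cX - 1)) →ₗ[IwasawaAlgebra 2] Xr)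
          (q : Xr →ₗ[IwasawaAlgebra 2] D.X)
          (fy : (Y' ⧸ LinearMap.range (cY - 1)) →ₗ[IwasawaAlgebra 2] Yd.X),
          Function.Exact toX π ∧ Function.Surjective π ∧ toX ∘ₗ cP = cX ∘ₗ toX ∧ π ∘ₗ cX = cY ∘ₗ π ∧
          Function.Injective col ∧
          col ∘ₗ cP = (LinearEquiv.prodComm (IwasawaAlgebra 2) (IwasawaAlgebra 2) (IwasawaAlgebra 2) :
            IwasawaAlgebra 2 × IwasawaAlgebra 2 →ₗ[IwasawaAlgebra 2]
              IwasawaAlgebra 2 × IwasawaAlgebra 2) ∘ₗ col ∧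
          Finite ((IwasawaAlgebra 2 × IwasawaAlgebra 2) ⧸ LinearMap.range col) ∧
          toX w₁ = 0 ∧ toX w₂ = 0 ∧ col w₁ = (a, b) ∧ col w₂ = (b, a) ∧
          s ∉ IwasawaAlgebra.augIdealP 2 ∧ a + b = PowerSeries.C ((2 : ℤ_[2]) ^ e) * s * Gp ∧
          Finite (Xr ⧸ LinearMap.range fd) ∧ Function.Surjective q ∧
          (e : ℕ∞) ≤ lengthAt (IwasawaAlgebra 2) (LinearMap.ker q)
              ⟨IwasawaAlgebra.augIdealP 2, IwasawaAlgebra.isPrime_augIdealP_holds 2⟩ ∧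
          lengthAt (IwasawaAlgebra 2) (LinearMap.ker fy)
              ⟨IwasawaAlgebra.augIdealP 2, IwasawaAlgebra.isPrime_augIdealP_holds 2⟩ = 0)
    (hA2 : ∀ (W : WeierstrassCurve ℚ) [W.IsElliptic] [W.IsGloballyMinimal], ¬ W.HasCM →
      IsOrdinaryAt W 2 → (∀ x : ℚ, ¬ HasRationalTwoTorsionX W x) → ¬ IsSquare W.Δ →
      W.analyticRank = 0 → BSDp W 2 →
      ∃ L : IntermediateField ℚ (AlgebraicClosure ℚ), L ≤ W.divisionField 4 ∧
        (∃ k : ℕ, Module.finrank ℚ (W.divisionField 4) = 2 ^ k * Module.finrank ℚ L) ∧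
        ∀ κL : ZpExtension L 2, κL.IsCyclotomic → ClassicalMuVanishes κL) :
    ∀ (W : WeierstrassCurve ℚ) [W.IsElliptic] [W.IsGloballyMinimal], ¬ W.HasCM →
      IsOrdinaryAt W 2 → (∀ x : ℚ, ¬ HasRationalTwoTorsionX W x) → ¬ IsSquare W.Δ →
      W.analyticRank = 0 →
      (∀ ⦃N : ℕ⦄ [NeZero N] (f : CuspForm (Gamma0 N) 2), IsNewformOf W f →
        ∀ G : IwasawaAlgebra 2, IsEvenBranchLiftAtTwo W f G → red G ≠ 0) →
      BSDp W 2 →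
      ∀ (κ : ZpExtension ℚ 2) (γ : Field.absoluteGaloisGroup ℚ), κ.IsCyclotomic →
        κ.IsTopGenerator γ → IsCyclotomicVariable 2 γ →
        ∀ D : W.SelmerDualData κ γ, D.IsTorsion → D.mu = 0 := by
  intro W _ _ hcm hord ht hsq hr hμan hbsd κ γ hκ hγ hγ' D _
  have hirr : Irr W 2 := AlignedTransportAtTwoSeed.irr_two_of_forall_not_hasRationalTwoTorsionX W ht
  haveI : NeZero (W.conductorNorm ℤ) := ⟨(W.conductorNorm_pos_holds).ne'⟩
  obtain ⟨Dm⟩ := hmod W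
  obtain ⟨Gp, hGp⟩ := exists_iwasawaToPowerSeries_eq_padicLFunction_two hord Dm.isNewformOf hirr
  have hred : red Gp ≠ 0 := hμan Dm.f Dm.isNewformOf Gp (Or.inl ⟨hord, hGp⟩)
  let Yd : W.FineSelmerDualData κ γ := W.fineSelmerDualData κ hγ
  obtain ⟨P, X', Y', Xr, _, _, _, _, _, _, _, _, toX, π, cP, cX, cY, col, w₁, w₂, a, b, s, e, fd, q, fy, hX, hπ,
    hcX, hcY, hcol, hccol, hfin, h₁, h₂, hw₁, hw₂, hs, hab, hfd, hq, he, hfy⟩ :=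
    hK2n W hord ht κ γ hκ hγ hγ' Dm.f Dm.isNewformOf Gp hGp D Yd
  obtain ⟨L, hL, hidx, hμL⟩ := hA2 W hcm hord ht hsq hr hbsd
  have hA := finite_fineSelmer_twoTorsion_of_classicalMu W hLim L hL hidx hμL κ hκ
  exact selmerDual_mu_eq_zero_of_roadB2_netting_strictFine_two W hγ D Yd hA hred toX π hX hπ cP cX cY hcX hcY
    col hcol hccol hfin h₁ h₂ hw₁ hw₂ hs hab fd hfd q hq he fy hfy

/-- **C2 BY NAME on the netted road (b″).** PRINT {Kato 17.4 (1)(2) at `2`, Greenberg 4.1, period unit,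
modularity, GZK, Lim 2017 Thm. 3.5 at `2`} + (K₂ⁿᵉᵗ) + (A₂) ⟹ `MainConjectureOfRankZeroBSDAtTwo`.
CONDITIONAL: the item stays open ((A₂) = Iwasawa's `μ = 0` for `S₃`-cubics; (K₂ⁿᵉᵗ) awaits typing — the
relaxed dual, Greenberg L. 4.6 at `2`, inf–res for the relaxed descent).
[cite: Kato2004Asterisque, Thm. 17.4 (p. 273) and §17.13 (pp. 279–280)] [cite: Lim2017FineSelmer, §3 Thm. 3.5 and Lemma 3.2]
[cite: GreenbergLNM1716, Thm. 4.1 (p. 102), Lemma 4.6 and Conj. 1.11 (p. 58)] -/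
theorem mainConjectureOfRankZeroBSDAtTwo_of_fineRoadNetting
    (h17 : ∀ (V : WeierstrassCurve ℚ) [V.IsElliptic] [V.IsGloballyMinimal] [NeZero (V.conductorNorm ℤ)]
      (f : CuspForm (Gamma0 (V.conductorNorm ℤ)) 2), kato_divisibility_allPrimes V 2 (f := f))
    (hGr : Greenberg1999.thm41_charValue_rankZero_anyPrime)
    (hper : realPeriodRat_eq_unit_mul_plusPeriod_two) (hmod : nonempty_modularParametrizationData)
    (hGZK : rank_eq_analyticRank_of_analyticRank_le_one)
    (hLim : Lim2017.thm35_at_two_fineSelmerDual_moduleFinite_of_classicalMuVanishes_of_le_divisionField_four)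
    (hK2n : ∀ (W : WeierstrassCurve ℚ) [W.IsElliptic] [W.IsGloballyMinimal], IsOrdinaryAt W 2 →
      (∀ x : ℚ, ¬ HasRationalTwoTorsionX W x) →
      ∀ (κ : ZpExtension ℚ 2) (γ : Field.absoluteGaloisGroup ℚ), κ.IsCyclotomic →
      κ.IsTopGenerator γ → IsCyclotomicVariable 2 γ →
      ∀ ⦃N : ℕ⦄ [NeZero N] (f : CuspForm (Gamma0 N) 2), IsNewformOf W f →
      ∀ Gp : IwasawaAlgebra 2, iwasawaToPowerSeries 2 Gp = padicLFunction f (unitRoot W 2 : ℚ_[2]) →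
      ∀ (D : W.SelmerDualData κ γ) (Yd : W.FineSelmerDualData κ γ),
        ∃ (P X' Y' Xr : Type) (_ : AddCommGroup P) (_ : _root_.Module (IwasawaAlgebra 2) P)
          (_ : AddCommGroup X') (_ : _root_.Module (IwasawaAlgebra 2) X')
          (_ : AddCommGroup Y') (_ : _root_.Module (IwasawaAlgebra 2) Y')
          (_ : AddCommGroup Xr) (_ : _root_.Module (IwasawaAlgebra 2) Xr)
          (toX : P →ₗ[IwasawaAlgebra 2] X') (π : X' →ₗ[IwasawaAlgebra 2] Y')
          (cP : P →ₗ[IwasawaAlgebra 2] P) (cX : X' →ₗ[IwasawaAlgebra 2] X')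
          (cY : Y' →ₗ[IwasawaAlgebra 2] Y')
          (col : P →ₗ[IwasawaAlgebra 2] IwasawaAlgebra 2 × IwasawaAlgebra 2) (w₁ w₂ : P)
          (a b s : IwasawaAlgebra 2) (e : ℕ) (fd : (X' ⧸ LinearMap.range (cX - 1)) →ₗ[IwasawaAlgebra 2] Xr)
          (q : Xr →ₗ[IwasawaAlgebra 2] D.X)
          (fy : (Y' ⧸ LinearMap.range (cY - 1)) →ₗ[IwasawaAlgebra 2] Yd.X),
          Function.Exact toX π ∧ Function.Surjective π ∧ toX ∘ₗ cP = cX ∘ₗ toX ∧ π ∘ₗ cX = cY ∘ₗ π ∧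
          Function.Injective col ∧
          col ∘ₗ cP = (LinearEquiv.prodComm (IwasawaAlgebra 2) (IwasawaAlgebra 2) (IwasawaAlgebra 2) :
            IwasawaAlgebra 2 × IwasawaAlgebra 2 →ₗ[IwasawaAlgebra 2]
              IwasawaAlgebra 2 × IwasawaAlgebra 2) ∘ₗ col ∧
          Finite ((IwasawaAlgebra 2 × IwasawaAlgebra 2) ⧸ LinearMap.range col) ∧
          toX w₁ = 0 ∧ toX w₂ = 0 ∧ col w₁ = (a, b) ∧ col w₂ = (b, a) ∧
          s ∉ IwasawaAlgebra.augIdealP 2 ∧ a + b = PowerSeries.C ((2 : ℤ_[2]) ^ e) * s * Gp ∧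
          Finite (Xr ⧸ LinearMap.range fd) ∧ Function.Surjective q ∧
          (e : ℕ∞) ≤ lengthAt (IwasawaAlgebra 2) (LinearMap.ker q)
              ⟨IwasawaAlgebra.augIdealP 2, IwasawaAlgebra.isPrime_augIdealP_holds 2⟩ ∧
          lengthAt (IwasawaAlgebra 2) (LinearMap.ker fy)
              ⟨IwasawaAlgebra.augIdealP 2, IwasawaAlgebra.isPrime_augIdealP_holds 2⟩ = 0)
    (hA2 : ∀ (W : WeierstrassCurve ℚ) [W.IsElliptic] [W.IsGloballyMinimal], ¬ W.HasCM →
      IsOrdinaryAt W 2 → (∀ x : ℚ, ¬ HasRationalTwoTorsionX W x) → ¬ IsSquare W.Δ →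
      W.analyticRank = 0 → BSDp W 2 →
      ∃ L : IntermediateField ℚ (AlgebraicClosure ℚ), L ≤ W.divisionField 4 ∧
        (∃ k : ℕ, Module.finrank ℚ (W.divisionField 4) = 2 ^ k * Module.finrank ℚ L) ∧
        ∀ κL : ZpExtension L 2, κL.IsCyclotomic → ClassicalMuVanishes κL) :
    MainConjectureOfRankZeroBSDAtTwo :=
  AlignedTransportAtTwoSeed.mainConjectureOfRankZeroBSDAtTwo_of_seedMuZero h17 hGr hper hmod hGZK
    (seedMuZeroAtTwo_of_fineRoadNetting hmod hLim hK2n hA2)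

end Crux

end Summit.BirchSwinnertonDyer.BirchSwinnertonDyer.Theorems.AlignedTransportAtTwoFineRoad

end
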